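import Mathlib

/-!
# `FeketeSOS.FeketeNoSparseSplit` (stmt-ValiantsHypothesis-3997), line `cyclic-valuation-dichotomy` — stub `stub_cyclicOrderDichotomy`

Order bookkeeping in the uniserial ring `K[X]/(X^p - 1) = K[y]/(y^p)` (`char K = p`, `X^p - 1 = (X-1)^p`):
if `A, B, F ≠ 0`, `deg F < p` and `X^p - 1 ∣ A·B - c·F`, then `ord₁ A + ord₁ B = ord₁ F` when `c ≠ 0` and
`ord₁ A + ord₁ B ≥ p` when `c = 0` (`ord₁ = rootMultiplicity 1`).
-/

namespace Summit.ValiantsHypothesis.ValiantsHypothesis.Theorems.FeketeNoSparseSplitCyclic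

open Polynomial

-- `Summit.ValiantsHypothesis.ValiantsHypothesis.…` is the tree's mandated single-conjunct layout (Sub = Summit).
set_option linter.dupNamespace false

/-- **The cyclic order dichotomy** in characteristic `p`. [folklore] -/
theorem stub_cyclicOrderDichotomy :
    ∀ (K : Type) [Field K] (p : ℕ) [Fact p.Prime] [CharP K p] (A B F : K[X]) (c : K),
      A ≠ 0 → B ≠ 0 → F ≠ 0 → F.natDegree < p →
      (X ^ p - 1 : K[X]) ∣ A * B - C c * F →
        (c ≠ 0 → rootMultiplicity (1 : K) A + rootMultiplicity (1 : K) B = rootMultiplicity (1 : K) F) ∧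
        (c = 0 → p ≤ rootMultiplicity (1 : K) A + rootMultiplicity (1 : K) B) := by
  intro K _ p _ _ A B F c hA hB hF hFdeg hdiv
  -- Frobenius: `X ^ p - 1 = (X - 1) ^ p` in characteristic `p`.
  have hXp : (X - C (1 : K)) ^ p = X ^ p - 1 := by
    rw [sub_pow_char, ← C_pow, one_pow, C_1]
  rw [← hXp] at hdiv
  obtain ⟨Q, hQ⟩ := hdiv
  have hAB0 : A * B ≠ 0 := mul_ne_zero hA hB
  have hABeq : A * B = C c * F + (X - C 1) ^ p * Q := by
    rw [← hQ]; ring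
  rw [← rootMultiplicity_mul hAB0]
  refine ⟨fun hc => ?_, fun hc => ?_⟩
  · -- `c ≠ 0`: `ord₁ (A * B) = ord₁ F`, because `ord₁ F ≤ deg F < p`.
    set n := rootMultiplicity (1 : K) F
    have hnle : n ≤ F.natDegree := by
      have h := natDegree_le_of_dvd (pow_rootMultiplicity_dvd F 1) hF
      rwa [(monic_X_sub_C (1 : K)).natDegree_pow, natDegree_X_sub_C, mul_one] at h
    have hnp : n < p := lt_of_le_of_lt hnle hFdeg
    apply le_antisymm
    · rw [rootMultiplicity_le_iff hAB0]
      intro hdvd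
      have h1 : (X - C (1 : K)) ^ (n + 1) ∣ (X - C 1) ^ p * Q :=
        dvd_mul_of_dvd_left (pow_dvd_pow _ (Nat.succ_le_of_lt hnp)) _
      have h2 : (X - C (1 : K)) ^ (n + 1) ∣ C c * F := by
        have h' : C c * F = A * B - (X - C 1) ^ p * Q := by rw [hABeq]; ring
        rw [h']
        exact dvd_sub hdvd h1
      have h3 : (X - C (1 : K)) ^ (n + 1) ∣ F := by
        have h' : F = C c⁻¹ * (C c * F) := by
          rw [← mul_assoc, ← C_mul, inv_mul_cancel₀ hc, C_1, one_mul]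
        rw [h']
        exact dvd_mul_of_dvd_right h2 _
      exact (rootMultiplicity_le_iff hF 1 n).1 le_rfl h3
    · rw [le_rootMultiplicity_iff hAB0, hABeq]
      exact dvd_add (dvd_mul_of_dvd_right (pow_rootMultiplicity_dvd F 1) _)
        (dvd_mul_of_dvd_left (pow_dvd_pow _ hnp.le) _)
  · -- `c = 0`: `(X - 1) ^ p ∣ A * B`.
    rw [le_rootMultiplicity_iff hAB0, hABeq, hc, map_zero, zero_mul, zero_add]
    exact dvd_mul_right _ _

end Summit.ValiantsHypothesis.ValiantsHypothesis.Theorems.FeketeNoSparseSplitCyclic
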